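import Summits.Ventures.WeilGRH.CharacterFamilyFlatTest
import Summits.Ventures.WeilGRH.TwistedSechSeries
import Literature.NumberTheory.LFunctions.WeilArchDensityMoments
import Mathlib.Analysis.SpecialFunctions.ImproperIntegrals
import HarnessLib

/-!
# GRH arm (rh-explicit, venture WeilGRH): the archimedean cost of the flat window, SHARPENED —
  `I₀(a) ≤ 4.361`, `I₁(a) ≤ 0.651` (true limits `ψ′(¼)/4 = 4.2993`, `ψ′(¾)/4 = 0.6354`)

Cell `rh-explicit`, WEIL TRACK (structure seat weil-3, gen8).  `TwistedFlatTestBounds.lean` bounded the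
archimedean cost `I_κ(a) = ∫₀^∞ ρ_κ(t) min(t, 2a) dt` of the flat-window inequality by `5` for both parities
(`tρ₀ ≤ e^{−t/2}(1 + 2t)/2`).  With the finite exponential split of the density
(`weilArchDensity_eq_sum_add_rem`: `ρ₀ = e^{−t/2} + e^{−5t/2} + rem₂`, `rem₂ ≤ e^{−9t/2}(1 + 1/(2t))`) and
`ρ₁ = e^{−t}ρ₀`:

  `I₀(a) ≤ ∫₀^∞ tρ₀ ≤ 4 + 4/25 + 4/81 + 1/9 ≤ 4.361`   (`integral_weilArchDensityPar_zero_mul_min_le`),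
  `I₁(a) ≤ ∫₀^∞ tρ₁ ≤ 4/9 + 4/49 + 4/121 + 1/11 ≤ 0.651`   (`integral_weilArchDensityPar_one_mul_min_le`)

(the limits `a → ∞` are `Σ_m (2m+½)^{−2} = ψ′(¼)/4 = 4.2993` and `Σ_m (2m+3/2)^{−2} = ψ′(¾)/4 = 0.6354`).
Consequences — the flat-window floors of `TwistedFlatTestFloor.lean` and the family floors of
`CharacterFamilyFlatTest.lean` with the sharper archimedean term:
`2S_χ(a) + 5.3716 − 4.361/a ≤ log q` (even), `2S_χ(a) + 2.23 − 0.651/a ≤ log q` (odd)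
(`flatWindow_floor_le_log_sharp_of_even/odd`; the odd floor at `a = 1` improves from `2S − 2.77` to
`2S + 1.579`), and `2φΣ_{n≡1 (q)} c_n + φ·(3.8008 − 2.506/a) ≤ (φ − 1) log q + 16 sinh²(a/2)/a`
(`characterFamily_flatWindow_floor_le_sharp`).

No definitions, no named facts, RH/GRH-free.
-/

set_option autoImplicit false

noncomputable section

open Complex Filter Set MeasureTheory
open scoped Real Topology ArithmeticFunction.vonMangoldt

namespace Summit.Ventures.WeilGRH

open Literature.NumberTheory.LFunctions

variable {q : ℕ} {a : ℝ}

/-! ## Elementary integrals (`∫₀^∞ t e^{−ct} = 1/c²` and its integrability are `TwistedSechSeries`'s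
`integral_mul_exp_neg_mul_Ioi`, `integrableOn_mul_exp_neg_mul_Ioi`) -/

/-- `∫₀^∞ e^{−lt}/2 dt = 1/(2l)` (`l > 0`). -/
theorem integral_exp_neg_mul_div_two_Ioi {l : ℝ} (hl : 0 < l) :
    ∫ t in Ioi (0 : ℝ), Real.exp (-(l * t)) / 2 = 1 / (2 * l) := by
  have h := integral_exp_mul_Ioi (a := -l) (by linarith) 0
  simp only [mul_zero, Real.exp_zero, neg_mul] at h
  rw [integral_div, h]
  field_simp

/-- `t ↦ e^{−lt}/2` is integrable on `(0, ∞)` (`l > 0`). -/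
theorem integrableOn_exp_neg_mul_div_two {l : ℝ} (hl : 0 < l) :
    IntegrableOn (fun t : ℝ ↦ Real.exp (-(l * t)) / 2) (Ioi 0) :=
  ((exp_neg_integrableOn_Ioi 0 hl).congr_fun (fun t _ ↦ by simp only [neg_mul]) measurableSet_Ioi).div_const 2

/-! ## Pointwise majorants from the finite exponential split -/

/-- **`tρ₀(t) ≤ t e^{−t/2} + t e^{−5t/2} + t e^{−9t/2} + e^{−9t/2}/2`** for `t > 0`
(`ρ₀ = e^{−t/2} + e^{−5t/2} + rem₂`, `rem₂ ≤ e^{−9t/2}(1 + 1/(2t))`). -/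
theorem mul_weilArchDensity_le_split {t : ℝ} (ht : 0 < t) :
    t * weilArchDensity t ≤ t * Real.exp (-(1 / 2 * t)) + t * Real.exp (-(5 / 2 * t)) +
      t * Real.exp (-(9 / 2 * t)) + Real.exp (-(9 / 2 * t)) / 2 := by
  have hsplit := weilArchDensity_eq_sum_add_rem ht 2
  have hrem := weilArchDensityRem_le ht 2
  rw [Finset.sum_range_succ, Finset.sum_range_succ, Finset.sum_range_zero, zero_add] at hsplit
  simp only [Nat.cast_zero, Nat.cast_one, mul_zero, zero_add, mul_one] at hsplit
  have h9 : Real.exp (-((2 * ((2 : ℕ) : ℝ) + 1 / 2) * t)) = Real.exp (-(9 / 2 * t)) := by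
    norm_num
  rw [h9] at hrem
  have hrem' : t * weilArchDensityRem 2 t ≤ t * Real.exp (-(9 / 2 * t)) + Real.exp (-(9 / 2 * t)) / 2 := by
    calc t * weilArchDensityRem 2 t ≤ t * (Real.exp (-(9 / 2 * t)) * (1 + 1 / (2 * t))) :=
          mul_le_mul_of_nonneg_left hrem ht.le
      _ = t * Real.exp (-(9 / 2 * t)) + Real.exp (-(9 / 2 * t)) / 2 := by field_simp
  have h25 : Real.exp (-((2 + 1 / 2 : ℝ) * t)) = Real.exp (-(5 / 2 * t)) := by norm_num
  rw [hsplit, h25]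
  have ht0 : 0 ≤ t := ht.le
  nlinarith [hrem', mul_nonneg ht0 (Real.exp_pos (-(1 / 2 * t))).le]

/-- `ρ₁ = e^{−t}·ρ₀`. -/
theorem weilArchDensityPar_one_eq_exp_mul (t : ℝ) :
    weilArchDensityPar 1 t = Real.exp (-t) * weilArchDensity t := by
  unfold weilArchDensityPar weilArchDensity
  rw [show ((1 : ℝ) / 2 - ((1 : ℕ) : ℝ)) * t = -t + t / 2 by push_cast; ring, Real.exp_add]
  ring

/-- **`tρ₁(t) ≤ t e^{−3t/2} + t e^{−7t/2} + t e^{−11t/2} + e^{−11t/2}/2`** for `t > 0`. -/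
theorem mul_weilArchDensityPar_one_le_split {t : ℝ} (ht : 0 < t) :
    t * weilArchDensityPar 1 t ≤ t * Real.exp (-(3 / 2 * t)) + t * Real.exp (-(7 / 2 * t)) +
      t * Real.exp (-(11 / 2 * t)) + Real.exp (-(11 / 2 * t)) / 2 := by
  have h := mul_weilArchDensity_le_split ht
  have hE : 0 < Real.exp (-t) := Real.exp_pos _
  rw [weilArchDensityPar_one_eq_exp_mul, show t * (Real.exp (-t) * weilArchDensity t) =
    Real.exp (-t) * (t * weilArchDensity t) by ring]
  have e3 : Real.exp (-t) * Real.exp (-(1 / 2 * t)) = Real.exp (-(3 / 2 * t)) := by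
    rw [← Real.exp_add]; congr 1; ring
  have e7 : Real.exp (-t) * Real.exp (-(5 / 2 * t)) = Real.exp (-(7 / 2 * t)) := by
    rw [← Real.exp_add]; congr 1; ring
  have e11 : Real.exp (-t) * Real.exp (-(9 / 2 * t)) = Real.exp (-(11 / 2 * t)) := by
    rw [← Real.exp_add]; congr 1; ring
  calc Real.exp (-t) * (t * weilArchDensity t)
      ≤ Real.exp (-t) * (t * Real.exp (-(1 / 2 * t)) + t * Real.exp (-(5 / 2 * t)) +
          t * Real.exp (-(9 / 2 * t)) + Real.exp (-(9 / 2 * t)) / 2) := mul_le_mul_of_nonneg_left h hE.le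
    _ = t * Real.exp (-(3 / 2 * t)) + t * Real.exp (-(7 / 2 * t)) +
          t * Real.exp (-(11 / 2 * t)) + Real.exp (-(11 / 2 * t)) / 2 := by
        rw [← e3, ← e7, ← e11]; ring

/-! ## The first moments: `∫₀^∞ tρ₀ ≤ 4.361`, `∫₀^∞ tρ₁ ≤ 0.651` -/

/-- **`∫₀^∞ ρ₀(t) min(t, 2a) dt ≤ 4.361`** for every `a ≥ 0` (`4 + 4/25 + 4/81 + 1/9 = 4.3605`; the limit
`a → ∞` is `ψ′(¼)/4 = 4.2993`). -/
theorem integral_weilArchDensityPar_zero_mul_min_le (ha : 0 ≤ a) :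
    ∫ t in Ioi (0 : ℝ), weilArchDensityPar 0 t * min t (2 * a) ≤ 4.361 := by
  have hi1 := integrableOn_mul_exp_neg_mul_Ioi (c := 1 / 2) (by norm_num)
  have hi2 := integrableOn_mul_exp_neg_mul_Ioi (c := 5 / 2) (by norm_num)
  have hi3 := integrableOn_mul_exp_neg_mul_Ioi (c := 9 / 2) (by norm_num)
  have h4' := integrableOn_exp_neg_mul_div_two (l := 9 / 2) (by norm_num)
  have h12 : IntegrableOn (fun t : ℝ ↦ t * Real.exp (-(1 / 2 * t)) + t * Real.exp (-(5 / 2 * t))) (Ioi 0) :=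
    hi1.add hi2
  have h123 : IntegrableOn (fun t : ℝ ↦ t * Real.exp (-(1 / 2 * t)) + t * Real.exp (-(5 / 2 * t)) +
      t * Real.exp (-(9 / 2 * t))) (Ioi 0) := h12.add hi3
  have hmaj : IntegrableOn (fun t : ℝ ↦ t * Real.exp (-(1 / 2 * t)) + t * Real.exp (-(5 / 2 * t)) +
      t * Real.exp (-(9 / 2 * t)) + Real.exp (-(9 / 2 * t)) / 2) (Ioi 0) := h123.add h4'
  have hval : ∫ t in Ioi (0 : ℝ), (t * Real.exp (-(1 / 2 * t)) + t * Real.exp (-(5 / 2 * t)) +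
      t * Real.exp (-(9 / 2 * t)) + Real.exp (-(9 / 2 * t)) / 2) = 4 + 4 / 25 + 4 / 81 + 1 / 9 := by
    rw [integral_add h123 h4', integral_add h12 hi3,
      integral_add hi1 hi2, integral_mul_exp_neg_mul_Ioi (by norm_num),
      integral_mul_exp_neg_mul_Ioi (by norm_num), integral_mul_exp_neg_mul_Ioi (by norm_num),
      integral_exp_neg_mul_div_two_Ioi (by norm_num)]
    norm_num
  calc ∫ t in Ioi (0 : ℝ), weilArchDensityPar 0 t * min t (2 * a)
      ≤ ∫ t in Ioi (0 : ℝ), (t * Real.exp (-(1 / 2 * t)) + t * Real.exp (-(5 / 2 * t)) +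
          t * Real.exp (-(9 / 2 * t)) + Real.exp (-(9 / 2 * t)) / 2) := by
        refine integral_mono_of_nonneg ?_ hmaj ?_
        · exact (ae_restrict_iff' measurableSet_Ioi).2 (Eventually.of_forall fun t (ht : 0 < t) ↦
            mul_nonneg (weilArchDensityPar_nonneg_le 0 ht).1 (le_min ht.le (by linarith)))
        · refine (ae_restrict_iff' measurableSet_Ioi).2 (Eventually.of_forall fun t (ht : 0 < t) ↦ ?_)
          obtain ⟨h0, hle⟩ := weilArchDensityPar_nonneg_le 0 ht
          calc weilArchDensityPar 0 t * min t (2 * a) ≤ weilArchDensity t * t :=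
                mul_le_mul hle (min_le_left _ _) (le_min ht.le (by linarith)) (weilArchDensity_pos ht).le
            _ = t * weilArchDensity t := mul_comm _ _
            _ ≤ _ := mul_weilArchDensity_le_split ht
    _ = 4 + 4 / 25 + 4 / 81 + 1 / 9 := hval
    _ ≤ 4.361 := by norm_num

/-- **`∫₀^∞ ρ₁(t) min(t, 2a) dt ≤ 0.651`** for every `a ≥ 0` (`4/9 + 4/49 + 4/121 + 1/11 = 0.6501`; the
limit `a → ∞` is `ψ′(¾)/4 = 0.6354`). -/
theorem integral_weilArchDensityPar_one_mul_min_le (ha : 0 ≤ a) :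
    ∫ t in Ioi (0 : ℝ), weilArchDensityPar 1 t * min t (2 * a) ≤ 0.651 := by
  have hi1 := integrableOn_mul_exp_neg_mul_Ioi (c := 3 / 2) (by norm_num)
  have hi2 := integrableOn_mul_exp_neg_mul_Ioi (c := 7 / 2) (by norm_num)
  have hi3 := integrableOn_mul_exp_neg_mul_Ioi (c := 11 / 2) (by norm_num)
  have h4' := integrableOn_exp_neg_mul_div_two (l := 11 / 2) (by norm_num)
  have h12 : IntegrableOn (fun t : ℝ ↦ t * Real.exp (-(3 / 2 * t)) + t * Real.exp (-(7 / 2 * t))) (Ioi 0) :=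
    hi1.add hi2
  have h123 : IntegrableOn (fun t : ℝ ↦ t * Real.exp (-(3 / 2 * t)) + t * Real.exp (-(7 / 2 * t)) +
      t * Real.exp (-(11 / 2 * t))) (Ioi 0) := h12.add hi3
  have hmaj : IntegrableOn (fun t : ℝ ↦ t * Real.exp (-(3 / 2 * t)) + t * Real.exp (-(7 / 2 * t)) +
      t * Real.exp (-(11 / 2 * t)) + Real.exp (-(11 / 2 * t)) / 2) (Ioi 0) := h123.add h4'
  have hval : ∫ t in Ioi (0 : ℝ), (t * Real.exp (-(3 / 2 * t)) + t * Real.exp (-(7 / 2 * t)) +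
      t * Real.exp (-(11 / 2 * t)) + Real.exp (-(11 / 2 * t)) / 2) = 4 / 9 + 4 / 49 + 4 / 121 + 1 / 11 := by
    rw [integral_add h123 h4', integral_add h12 hi3,
      integral_add hi1 hi2, integral_mul_exp_neg_mul_Ioi (by norm_num),
      integral_mul_exp_neg_mul_Ioi (by norm_num), integral_mul_exp_neg_mul_Ioi (by norm_num),
      integral_exp_neg_mul_div_two_Ioi (by norm_num)]
    norm_num
  calc ∫ t in Ioi (0 : ℝ), weilArchDensityPar 1 t * min t (2 * a)
      ≤ ∫ t in Ioi (0 : ℝ), (t * Real.exp (-(3 / 2 * t)) + t * Real.exp (-(7 / 2 * t)) +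
          t * Real.exp (-(11 / 2 * t)) + Real.exp (-(11 / 2 * t)) / 2) := by
        refine integral_mono_of_nonneg ?_ hmaj ?_
        · exact (ae_restrict_iff' measurableSet_Ioi).2 (Eventually.of_forall fun t (ht : 0 < t) ↦
            mul_nonneg (weilArchDensityPar_nonneg_le 1 ht).1 (le_min ht.le (by linarith)))
        · refine (ae_restrict_iff' measurableSet_Ioi).2 (Eventually.of_forall fun t (ht : 0 < t) ↦ ?_)
          obtain ⟨h0, -⟩ := weilArchDensityPar_nonneg_le 1 ht
          calc weilArchDensityPar 1 t * min t (2 * a) ≤ weilArchDensityPar 1 t * t :=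
                mul_le_mul_of_nonneg_left (min_le_left _ _) h0
            _ = t * weilArchDensityPar 1 t := mul_comm _ _
            _ ≤ _ := mul_weilArchDensityPar_one_le_split ht
    _ = 4 / 9 + 4 / 49 + 4 / 121 + 1 / 11 := hval
    _ ≤ 0.651 := by norm_num

open scoped Classical in
/-- The parity-wise cost: `I_{κ(χ)}(a) ≤ 4.361` (even) / `0.651` (odd). -/
theorem integral_weilArchDensityPar_mul_min_le_parity [NeZero q] (χ : DirichletCharacter ℂ q) (ha : 0 ≤ a) :
    ∫ t in Ioi (0 : ℝ), weilArchDensityPar (charParity χ) t * min t (2 * a) ≤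
      if χ.Even then 4.361 else 0.651 := by
  rcases χ.even_or_odd with h | h
  · rw [if_pos h, charParity_of_even h]; exact integral_weilArchDensityPar_zero_mul_min_le ha
  · rw [if_neg h.not_even, charParity_of_odd h]; exact integral_weilArchDensityPar_one_mul_min_le ha

/-! ## Sharper floors -/

/-- **Even floor, sharp archimedean term**: `WeilPositivityOnChar χ a`, `χ` even, `q ≠ 1`, `a > 0` ⟹
`2S_χ(a) + 5.3716 − 4.361/a ≤ log q`. -/
theorem flatWindow_floor_le_log_sharp_of_even [NeZero q] (hq : q ≠ 1) (χ : DirichletCharacter ℂ q)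
    (hχ : χ.Even) (ha : 0 < a) (hW : WeilPositivityOnChar χ a) :
    2 * (∑ n ∈ weilPrimeIndex a,
          (Λ n : ℝ) / Real.sqrt n * ((1 - Real.log n / (2 * a)) * (χ (n : ZMod q)).re)) +
        5.3716 - 4.361 / a ≤ Real.log q := by
  have h := flatWindow_le_log_of_weilPositivityOnChar hq χ ha hW
  rw [charParity_of_even hχ] at h
  have hK := flatWindow_const_zero_ge
  have hI := integral_weilArchDensityPar_zero_mul_min_le ha.le
  have hIa : 1 / a * ∫ t in Ioi (0 : ℝ), weilArchDensityPar 0 t * min t (2 * a) ≤ 4.361 / a := by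
    rw [one_div_mul_eq_div]
    exact div_le_div_of_nonneg_right hI ha.le
  linarith

/-- **Odd floor, sharp archimedean term**: `WeilPositivityOnChar χ a`, `χ` odd, `q ≠ 1`, `a > 0` ⟹
`2S_χ(a) + 2.23 − 0.651/a ≤ log q` (at `a = 1`: `2S + 1.579 ≤ log q`, against `2S − 2.77` with the crude
cost `5`). -/
theorem flatWindow_floor_le_log_sharp_of_odd [NeZero q] (hq : q ≠ 1) (χ : DirichletCharacter ℂ q)
    (hχ : χ.Odd) (ha : 0 < a) (hW : WeilPositivityOnChar χ a) :
    2 * (∑ n ∈ weilPrimeIndex a,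
          (Λ n : ℝ) / Real.sqrt n * ((1 - Real.log n / (2 * a)) * (χ (n : ZMod q)).re)) +
        2.23 - 0.651 / a ≤ Real.log q := by
  have h := flatWindow_le_log_of_weilPositivityOnChar hq χ ha hW
  rw [charParity_of_odd hχ] at h
  have hK := flatWindow_const_one_ge
  have hI := integral_weilArchDensityPar_one_mul_min_le ha.le
  have hIa : 1 / a * ∫ t in Ioi (0 : ℝ), weilArchDensityPar 1 t * min t (2 * a) ≤ 0.651 / a := by
    rw [one_div_mul_eq_div]
    exact div_le_div_of_nonneg_right hI ha.le
  linarith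

open scoped Classical in
/-- Per character, sharp: `K_{κ(χ)} − I_{κ(χ)}(a)/a ≥ c(χ) − b(χ)/a` with `(c, b) = (5.3716, 4.361)` even /
`(2.23, 0.651)` odd. -/
theorem flatWindow_archConst_ge_sharp [NeZero q] (ha : 0 < a) (χ : DirichletCharacter ℂ q) :
    (if χ.Even then (5.3716 : ℝ) else 2.23) - (if χ.Even then (4.361 : ℝ) else 0.651) / a ≤
      (Real.log (4 * π) + Real.eulerMascheroniConstant +
          2 * ∫ t in Ioi (0 : ℝ), weilKillingDensityPar (charParity χ) t) -
        1 / a * ∫ t in Ioi (0 : ℝ), weilArchDensityPar (charParity χ) t * min t (2 * a) := by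
  have hI := integral_weilArchDensityPar_mul_min_le_parity χ ha.le
  have hIa : 1 / a * ∫ t in Ioi (0 : ℝ), weilArchDensityPar (charParity χ) t * min t (2 * a) ≤
      (if χ.Even then (4.361 : ℝ) else 0.651) / a := by
    rw [one_div_mul_eq_div]
    exact div_le_div_of_nonneg_right hI ha.le
  split_ifs at hIa ⊢ with h
  · rw [charParity_of_even h] at hIa ⊢
    have hK := flatWindow_const_zero_ge
    linarith
  · have hK := flatWindow_const_ge χ
    linarith

open scoped Classical in
/-- For `q ≥ 3`: `Σ_χ b(χ) = 2.506·φ(q)` (`b = 4.361` even / `0.651` odd; half the characters are even). -/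
theorem sum_parityCost_eq [NeZero q] (hq : 2 < q) :
    ∑ χ : DirichletCharacter ℂ q, (if χ.Even then (4.361 : ℝ) else 0.651) = 2.506 * (q.totient : ℝ) := by
  classical
  haveI : Fact (2 < q) := ⟨hq⟩
  have hc : ∀ χ : DirichletCharacter ℂ q,
      (if χ.Even then (4.361 : ℝ) else 0.651) = 2.506 + 1.855 * (χ (-1)).re := by
    intro χ
    rcases χ.even_or_odd with h | h
    · rw [if_pos h, show χ (-1) = 1 from h]; norm_num
    · rw [if_neg h.not_even, show χ (-1) = -1 from h]; norm_num
  simp_rw [hc]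
  rw [Finset.sum_add_distrib, Finset.sum_const, card_dirichletCharacter_eq_totient, nsmul_eq_mul,
    ← Finset.mul_sum, ← Complex.re_sum, re_sum_characters_apply, if_neg ZMod.neg_one_ne_one]
  ring

/-- **THE FAMILY INEQUALITY WITH THE SHARP ARCHIMEDEAN TERM** (`q ≥ 3`, `a > 0`): if every character mod
`q` has its rung at `a` (`ζ` included), then
`2φ(q)·Σ_{log n<2a, n≡1 (q)} Λ(n)n^{-1/2}(1 − log n/(2a)) + φ(q)·(3.8008 − 2.506/a) ≤ (φ(q) − 1) log q + 16 sinh²(a/2)/a`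
(`CharacterFamilyFlatTest.characterFamily_flatWindow_floor_le` had `5/a`). -/
theorem characterFamily_flatWindow_floor_le_sharp [NeZero q] (hq : 2 < q) (ha : 0 < a)
    (hζ : WeilPositivityOn a) (hχ : ∀ χ : DirichletCharacter ℂ q, χ ≠ 1 → WeilPositivityOnChar χ a) :
    2 * (q.totient : ℝ) * (∑ n ∈ (weilPrimeIndex a).filter (fun n : ℕ ↦ (n : ZMod q) = 1),
          (Λ n : ℝ) / Real.sqrt n * (1 - Real.log n / (2 * a))) +
        (q.totient : ℝ) * (3.8008 - 2.506 / a) ≤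
      ((q.totient : ℝ) - 1) * Real.log q + 16 * Real.sinh (a / 2) ^ 2 / a := by
  classical
  have hq1 : q ≠ 1 := by omega
  have h := characterFamily_flatWindow_le hq1 ha hζ hχ
  have hlow : ∑ χ : DirichletCharacter ℂ q,
      ((if χ.Even then (5.3716 : ℝ) else 2.23) - (if χ.Even then (4.361 : ℝ) else 0.651) / a) ≤
      ∑ χ : DirichletCharacter ℂ q,
        ((Real.log (4 * π) + Real.eulerMascheroniConstant +
            2 * ∫ t in Ioi (0 : ℝ), weilKillingDensityPar (charParity χ) t) -
          1 / a * ∫ t in Ioi (0 : ℝ), weilArchDensityPar (charParity χ) t * min t (2 * a)) :=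
    Finset.sum_le_sum fun χ _ ↦ flatWindow_archConst_ge_sharp ha χ
  rw [Finset.sum_sub_distrib, sum_parityConst_eq hq, ← Finset.sum_div, sum_parityCost_eq hq] at hlow
  have e : (2.506 : ℝ) * (q.totient : ℝ) / a = (q.totient : ℝ) * (2.506 / a) := by ring
  rw [e] at hlow
  linarith

end Summit.Ventures.WeilGRH

end
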